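import Mathlib
import HarnessLib
import Summits.Ventures.LatticeQCDFlow.Scoring.SU3WeylDensityTracePolynomial

/-!
# The sharp bound on the `SU(3)` Weyl density: `|Δ|² ≤ 27`, with equality exactly at the traceless points of the torus

HONEST FRAMING: exact (Metropolis-corrected) sampling algorithms for lattice gauge theory;
figures of merit are autocorrelation/cost numbers at stated couplings and volumes; no
continuum-physics claim.

Venture `LatticeQCDFlow` (cell pub-lqcd), sub-topic `Scoring`; FANOUT row 21 (`su3-base`: the 4D
`SU(3)` baselines).  NEW WORK of the cell (placement rule), elementary, over row 21 GEN-8's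
`Scoring/SU3WeylDensityTracePolynomial` (`weylSU3 = 27 − 18|t|² + 8 Re t³ − |t|⁴`) and row 5's
`Scoring/OnePlaquetteSU3` (`weylSU3`); it SHARPENS row 5's `OnePlaquetteSU3FreeEnergy.weylSU3_le`
(`weylSU3 ≤ 64`) to the optimal constant.  No definition is introduced; nothing is cited as a fact;
no number of ours.

With `r = |t|` and `Re t³ ≤ |t|³ = r³`:
`weylSU3 = 27 − 18 r² + 8 Re t³ − r⁴ ≤ 27 − r²(r² − 8r + 18) ≤ 27`, because `r² − 8r + 18 =
(r − 4)² + 2 > 0`.  Equality forces `r = 0`, i.e. `t = 0`: the product of the three squared chord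
lengths of three unimodular points with product one is at most `27`, attained exactly by the
equilateral configuration `{λ, λω, λω²}` (here: eigenvalues `1, ω, ω²` up to the centre), the
traceless class of `Scoring/SU3TracelessOrderThree`.

## What is proved

* **`weylSU3_le_twentySeven`** — `weylSU3 θ₁ θ₂ ≤ 27` for all `θ₁, θ₂`;
* **`weylSU3_eq_twentySeven_iff`** — `weylSU3 θ₁ θ₂ = 27 ⇔ e^{iθ₁} + e^{iθ₂} + e^{−i(θ₁+θ₂)} = 0`;
* `weylSU3_lt_twentySeven_of_trace_ne_zero` — strict inequality off the traceless points.

NOT CLAIMED: any integral consequence (e.g. bounds on the one-plaquette partition function beyond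
replacing `64` by `27`); anything for `N ≠ 3`.
-/

namespace Summit.Ventures.LatticeQCDFlow.Scoring

open Complex Real

/-- **`weylSU3 ≤ 27`** (sharp; row 5's bound was `64`). -/
theorem weylSU3_le_twentySeven (θ₁ θ₂ : ℝ) : weylSU3 θ₁ θ₂ ≤ 27 := by
  rw [weylSU3_eq_trace_polynomial]
  set t : ℂ := Complex.exp ((θ₁ : ℂ) * Complex.I) + Complex.exp ((θ₂ : ℂ) * Complex.I) +
      Complex.exp (((-(θ₁ + θ₂) : ℝ) : ℂ) * Complex.I) with ht
  have h3 : (t ^ 3).re ≤ ‖t‖ ^ 3 := by rw [← norm_pow]; exact Complex.re_le_norm _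
  have hr := norm_nonneg t
  -- `27 − 18r² + 8 Re t³ − r⁴ ≤ 27 − r²((r − 4)² + 2) ≤ 27`
  nlinarith [sq_nonneg (‖t‖ - 4), sq_nonneg ‖t‖, mul_nonneg hr (sq_nonneg (‖t‖ - 4))]

/-- **`weylSU3 = 27` iff the torus point is traceless** (`e^{iθ₁} + e^{iθ₂} + e^{−i(θ₁+θ₂)} = 0`, the
equilateral eigenvalue configuration). -/
theorem weylSU3_eq_twentySeven_iff (θ₁ θ₂ : ℝ) :
    weylSU3 θ₁ θ₂ = 27 ↔
      Complex.exp ((θ₁ : ℂ) * Complex.I) + Complex.exp ((θ₂ : ℂ) * Complex.I) +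
        Complex.exp (((-(θ₁ + θ₂) : ℝ) : ℂ) * Complex.I) = 0 := by
  rw [weylSU3_eq_trace_polynomial]
  set t : ℂ := Complex.exp ((θ₁ : ℂ) * Complex.I) + Complex.exp ((θ₂ : ℂ) * Complex.I) +
      Complex.exp (((-(θ₁ + θ₂) : ℝ) : ℂ) * Complex.I) with ht
  constructor
  · intro h
    have h3 : (t ^ 3).re ≤ ‖t‖ ^ 3 := by rw [← norm_pow]; exact Complex.re_le_norm _
    have hr := norm_nonneg t
    -- `r²((r−4)² + 2) ≤ 8(Re t³ − r³) ≤ 0` forces `r = 0`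
    have hr0 : ‖t‖ = 0 := by
      nlinarith [sq_nonneg (‖t‖ - 4), sq_nonneg ‖t‖, mul_nonneg hr (sq_nonneg (‖t‖ - 4)),
        mul_nonneg (mul_nonneg hr hr) (sq_nonneg (‖t‖ - 4))]
    exact norm_eq_zero.mp hr0
  · intro h
    rw [h]
    simp

/-- Off the traceless points the Weyl density is strictly below `27`. -/
theorem weylSU3_lt_twentySeven_of_trace_ne_zero {θ₁ θ₂ : ℝ}
    (h : Complex.exp ((θ₁ : ℂ) * Complex.I) + Complex.exp ((θ₂ : ℂ) * Complex.I) +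
        Complex.exp (((-(θ₁ + θ₂) : ℝ) : ℂ) * Complex.I) ≠ 0) :
    weylSU3 θ₁ θ₂ < 27 :=
  lt_of_le_of_ne (weylSU3_le_twentySeven θ₁ θ₂) (fun h27 => h ((weylSU3_eq_twentySeven_iff θ₁ θ₂).mp h27))

end Summit.Ventures.LatticeQCDFlow.Scoring
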